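import Summits.QuantumFields.BalabanUV.Beta.MultiscaleSupMemberBall
import Summits.QuantumFields.BalabanUV.Beta.MultiscaleDecayDirichlet
import Summits.QuantumFields.BalabanUV.Beta.MultiscaleParametrixTorus

/-!
# Beta / MultiscaleSupMemberBallDirichlet — file 9a's ℓ²-LOCALIZED BOUND ON A `d_n`-BALL FOR THE LOCAL DIRICHLET INVERSES
# `dirInv (levelOp) χ` ON EVERY DOMAIN: the same shape as `MultiscaleSupMemberBall.real_ballNorm_levelOp_inverse_le` with `μ₀ ↦ min(μ₀,1)`,
# uniformly in the domain `χ` — first brick «9a-Dirichlet» of the LOCAL sup member that the level-free WRS-currency parametrix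
# (w4-d)∕(w4-f) needs for its pieces `G′_z` (MODEL; unit `b2b-balaban-beta-d4-p2`, GEN 11)

WHAT IS CERTIFIED (kernel, 0 sorry).  In the MODEL setting of `MultiscaleDecay.hc_levelOp` (isometric `Rm`, `T`; (P) budget; cell-sum
coercivity `C`; `0 ≤ κ ≤ 1`; margin `μ₀ > 0`), graded sides with the sitewise additive datum, ANY {0,1}-valued `χ` (domain `Ω₀ = {χ = 1}`):
* `dirInv_apply_eq` — `(G′u)(q) = χ(q)·((Ω₀AΩ₀ + (1 − Ω₀))⁻¹(χu))(q)`;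
* `levelOp_dirInv_apply_of_mem` — ON the domain `G′` inverts `A`: `χ(q) = 1 ⟹ (A(G′u))(q) = u(q)` (pv21 `sandwichΩ_mul_dirInv`, positivity from
  `MultiscaleParametrixTorus.posDef_of_coercive`; `coer_pos_of_margin`: the margin `μ₀ > 0` gives `C > 0`);
* **`real_ballNorm_dirInv_le`** — for `u` supported in cell `k′`, a site `x₀` and a radius `ρ₀`:
  `√(Σ_{d_n(q,x₀) ≤ ρ₀}(G′u)(q)²) ≤ e^{−κ(d_n(x₀,t_{k′}) − ρ₀ − 2d)}∕√((m₀(Γn(x₀))⁻²)(m₀S_{l_{k′}}⁻²))·√(Σ_{cell k′}u²)`, `m₀ = min(μ₀,1)`,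
  `Γ = L^A e^{(log L/R)ρ₀}` — file 6's `real_set_norm_inverse_le` for the SANDWICH with this lineage's `MultiscaleDecayDirichlet.hc_sandwich`
  (sitewise conjugated coercivity, profile `m₀·n⁻²`), the outer `χ` costing nothing (`χ² ≤ 1`).
(unit `b2b-balaban-beta-d4-p2`, GEN 11, MODEL crew; journal l.23681 ff.; consumer: «9b-Dirichlet» = the sup member for `G′` at interior points.)

HONEST FRAMING: discharging `BetaPertH` makes Bałaban's UV stability UNCONDITIONAL — NOT the continuum limit, NOT the Clay problem.
HONEST DEPENDENCY (verbatim): «continuum YM on T⁴ ⇐ BetaPertH ∧ nine spine estimates (0/9 proved); BetaPertH ⇐ (D1) ∧ (D4) ∧ CAP+tail;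
G-an2-4 gates asym, D1 and NE2/3/4.»  THIS MODULE DISCHARGES NOTHING of `BetaPertH`, asserts NOTHING printed and cites nothing as a fact
(ABSOLUTE RULE): [folklore] finite-dimensional bookkeeping about the MODEL operator; nothing of Bałaban's G′(U)∕G′_□.  LOCATORS (shape only):
[Balaban1985BackgroundPropagators] p. 394 (Ω₀Δ′Ω₀, G′), Thm 3.1 (3.42)∕(3.46) pp. 397–398, (3.86)–(3.88) pp. 408–409.  No class change on row D4
(critical-path width 0; D4 DISCHARGE NO DATE); NOT BetaPertH, NOT continuum, NOT Clay, NOT summit progress.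
-/

open scoped BigOperators
open Finset

namespace Summit.QuantumFields.BalabanUV.Beta.MultiscaleSupMemberBallDirichlet

open Summit.QuantumFields.BalabanUV.Beta.MultiscaleCombesThomasL2Real (real_set_norm_inverse_le)
open Summit.QuantumFields.BalabanUV.Beta.MultiscaleCombesThomasL2CellsGraded (siteScale_ctrU)
open Summit.QuantumFields.BalabanUV.Beta.BoxPoincare (Box)
open Summit.QuantumFields.BalabanUV.Beta.MultiscaleCoerciveTorus
open Summit.QuantumFields.BalabanUV.Beta.MultiscaleDistance
open Summit.QuantumFields.BalabanUV.Beta.MultiscaleDistanceGraded (scale_le_scale_mul_exp_add)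
open Summit.QuantumFields.BalabanUV.Beta.MultiscaleDistanceMetric (sdist_comm sdist_triangle_torus)
open Summit.QuantumFields.BalabanUV.Beta.MultiscaleDecayBudget
open Summit.QuantumFields.BalabanUV.Beta.MultiscaleDecayDirichlet (hc_sandwich decay_dirInv_levelOp)
open Summit.QuantumFields.BalabanUV.Beta.MultiscaleParametrixTorus (posDef_of_coercive)
open Summit.QuantumFields.BalabanUV.Beta.AccretiveCombesThomasSandwichSite (sdist_corner_thresholds)
open Summit.QuantumFields.BalabanUV.Beta.MultiscaleSupMemberBall (scale_pow_le sqrt_mul_pow cell_norm_le_of_abs_le)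
open Literature.MathematicalPhysics.QuantumFieldTheory.Balaban1983to89
open Literature.MathematicalPhysics.QuantumFieldTheory.Balaban1983to89.B9Thm37Sum (mulOp mulOp_apply)
open Literature.MathematicalPhysics.QuantumFieldTheory.Balaban1983to89.B9Thm37GluePU (bsrc btgt)
open Literature.MathematicalPhysics.QuantumFieldTheory.Balaban1983to89.B9Thm37GlueTorusInv (dirInv sandwichΩ_mul_dirInv)
open Literature.MathematicalPhysics.QuantumFieldTheory.Balaban1983to89.B9Thm37GlueTorusCov (tblk)
open Literature.MathematicalPhysics.QuantumFieldTheory.Balaban1983to89.B9Thm37GlueTorusCovLevels (levelOp)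
open B5TorusCover (UT Ctr ctrU)

noncomputable section

/-! ## §1 Generic: the Dirichlet inverse applied to a field -/

section Generic

variable {X : Type}

/-- `(G′u)(q) = χ(q)·((Ω₀AΩ₀ + (1 − Ω₀))⁻¹(χ·u))(q)`. [folklore] -/
theorem dirInv_apply_eq (A : Module.End ℝ (X → ℝ)) (χ : X → ℝ) (u : X → ℝ) (q : X) :
    dirInv A χ u q = χ q * Ring.inverse (mulOp χ * A * mulOp χ + mulOp (1 - χ) : Module.End ℝ (X → ℝ)) (fun p => χ p * u p) q := by
  rw [dirInv, Module.End.mul_apply, Module.End.mul_apply, mulOp_apply]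
  rfl

variable [Fintype X]

/-- **On the domain, `G′` inverts `A`**: if `A` is strictly positive and `χ` is {0,1}-valued, then for every `q` with `χ q = 1`,
`(A(G′u))(q) = u(q)` (from pv21's `Ω₀AΩ₀G′ = Ω₀` and `G′ = Ω₀G′`). [folklore] -/
theorem apply_dirInv_of_mem {A : Module.End ℝ (X → ℝ)} (hA : ∀ f : X → ℝ, f ≠ 0 → 0 < ∑ x, f x * A f x)
    {χ : X → ℝ} (hχ : ∀ x, χ x = 0 ∨ χ x = 1) (u : X → ℝ) (q : X) (hq : χ q = 1) : A (dirInv A χ u) q = u q := by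
  have h := sandwichΩ_mul_dirInv hA hχ
  have happ := congrArg (fun T : Module.End ℝ (X → ℝ) => T u q) h
  simp only [Module.End.mul_apply, mulOp_apply] at happ
  -- `χ·(G′u) = G′u` since `G′ = Ω₀(…)Ω₀`
  have hχG : (fun p => χ p * dirInv A χ u p) = dirInv A χ u := by
    funext p
    rw [dirInv_apply_eq]
    rcases hχ p with h0 | h1
    · rw [h0]; ring
    · rw [h1]; ring
  have hmul : mulOp χ (dirInv A χ u) = dirInv A χ u := by
    funext p; rw [mulOp_apply]; exact congrFun hχG p
  rw [hmul, hq, one_mul, one_mul] at happ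
  exact happ

end Generic

/-! ## §2 The ℓ²-localized bound on a `d_n`-ball for the Dirichlet inverses -/

variable {d : ℕ} {N : Fin d → ℕ} [∀ i, NeZero (N i)] [NeZero d] {Cp J K : Type} [Fintype Cp] [DecidableEq Cp] [Nonempty Cp]
  [Fintype J] [Fintype K] [DecidableEq K] (S : J → ℕ) (hS : ∀ l, 1 ≤ S l) (hdivS : ∀ l i, S l ∣ N i) (lvl : K → J)
  (zc : (k : K) → Ctr N (S (lvl k)))

omit [NeZero d] [DecidableEq Cp] [Nonempty Cp] [DecidableEq K] in
/-- **ON THE DOMAIN THE DIRICHLET INVERSE INVERTS `levelOp`**: under the cell-sum coercivity with `C > 0` (so `levelOp` is strictly positive,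
`MultiscaleParametrixTorus.posDef_of_coercive`) and for a {0,1}-valued `χ`: `χ q = 1 ⟹ (levelOp (G′u))(q) = u(q)`. [folklore] -/
theorem levelOp_dirInv_apply_of_mem
    (hdisj : ∀ k k' v v', cellPt S hS hdivS lvl zc k v = cellPt S hS hdivS lvl zc k' v' → k = k')
    (hcover : ∀ x : UT N, ∃ k, ∃ v : Box d (S (lvl k)), cellPt S hS hdivS lvl zc k v = x)
    (Rm : UT N × Fin d → Cp → Cp → ℝ) (T : J → UT N → Cp → Cp → ℝ) (a : J → ℝ) (ω : J → UT N → ℝ) (c : UT N × Fin d → ℝ)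
    {C : ℝ} (hC : 0 < C)
    (hcoer : ∀ f : UT N × Cp → ℝ,
      C * ∑ k, ((S (lvl k) : ℝ) ^ 2)⁻¹ * ∑ v : Box d (S (lvl k)), ∑ i, f (cellPt S hS hdivS lvl zc k v, i) ^ 2 ≤
        ∑ p, f p * levelOp bsrc btgt c Rm (fun l x => ctrU N (S l) (tblk (hS l) (hdivS l) x))
          (fun l x => ω l (ctrU N (S l) (tblk (hS l) (hdivS l) x))) T a f p)
    (χ : UT N × Cp → ℝ) (hχ : ∀ p, χ p = 0 ∨ χ p = 1) (u : UT N × Cp → ℝ) (q : UT N × Cp) (hq : χ q = 1) :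
    levelOp bsrc btgt c Rm (fun l x => ctrU N (S l) (tblk (hS l) (hdivS l) x))
        (fun l x => ω l (ctrU N (S l) (tblk (hS l) (hdivS l) x))) T a
      (dirInv (levelOp bsrc btgt c Rm (fun l x => ctrU N (S l) (tblk (hS l) (hdivS l) x))
        (fun l x => ω l (ctrU N (S l) (tblk (hS l) (hdivS l) x))) T a) χ u) q = u q :=
  apply_dirInv_of_mem (posDef_of_coercive S hS hdivS lvl zc hdisj hcover _ hC hcoer) hχ u q hq

/-- The margin `μ₀ > 0` forces `C > 0`. [folklore] -/
theorem coer_pos_of_margin {C cmax amax κ : ℝ} {d : ℕ} (hamax : 0 ≤ amax) (hκ0 : 0 ≤ κ)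
    (hμ : 0 < C - 2 * d * cmax ^ 2 * κ ^ 2 - amax * (Real.exp (2 * d * κ) - 1)) : 0 < C := by
  have h1 : 0 ≤ 2 * (d : ℝ) * cmax ^ 2 * κ ^ 2 := by positivity
  have h2 : 0 ≤ amax * (Real.exp (2 * d * κ) - 1) :=
    mul_nonneg hamax (by linarith [Real.one_le_exp_iff.mpr (by positivity : (0:ℝ) ≤ 2 * d * κ)])
  linarith

variable
    (hdisj : ∀ k k' v v', cellPt S hS hdivS lvl zc k v = cellPt S hS hdivS lvl zc k' v' → k = k')
    (hcover : ∀ x : UT N, ∃ k, ∃ v : Box d (S (lvl k)), cellPt S hS hdivS lvl zc k v = x)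
    (Rm : UT N × Fin d → Cp → Cp → ℝ) (hRm : ∀ b i j, ∑ k, Rm b k i * Rm b k j = if i = j then (1 : ℝ) else 0)
    (T : J → UT N → Cp → Cp → ℝ) (hT : ∀ l x i i', ∑ k, T l x k i * T l x k i' = if i = i' then (1 : ℝ) else 0)
    (a : J → ℝ) (ha : ∀ j, 0 ≤ a j) (ω : J → UT N → ℝ)
    (hsupp : ∀ l x, ω l (ctrU N (S l) (tblk (hS l) (hdivS l) x)) ≠ 0 → ∃ k v, lvl k = l ∧ cellPt S hS hdivS lvl zc k v = x)
    {amax : ℝ} (hamax : 0 ≤ amax)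
    (hscale : ∀ k, a (lvl k) * ω (lvl k) (ctrU N (S (lvl k)) (zc k)) ^ 2 * (S (lvl k) : ℝ) ^ d ≤ amax / (S (lvl k) : ℝ) ^ 2)
    (c : UT N × Fin d → ℝ) {cmax : ℝ} (hc : ∀ b, |c b| ≤ cmax) {C : ℝ}
    (hcoer : ∀ f : UT N × Cp → ℝ,
      C * ∑ k, ((S (lvl k) : ℝ) ^ 2)⁻¹ * ∑ v : Box d (S (lvl k)), ∑ i, f (cellPt S hS hdivS lvl zc k v, i) ^ 2 ≤
        ∑ p, f p * levelOp bsrc btgt c Rm (fun l x => ctrU N (S l) (tblk (hS l) (hdivS l) x))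
          (fun l x => ω l (ctrU N (S l) (tblk (hS l) (hdivS l) x))) T a f p)
    {κ : ℝ} (hκ0 : 0 ≤ κ) (hκ1 : κ ≤ 1)

include hdisj hRm hT ha hsupp hamax hscale hc hcoer hκ0 hκ1

/-- **THE ℓ²-LOCALIZED BOUND ON A `d_n`-BALL FOR THE DIRICHLET INVERSES, EVERY DOMAIN.**  Graded level sides `S_l = L^{e_l}` (`1 ≤ L`,
`0 < R`) with the SITEWISE additive datum; `χ` {0,1}-valued; `u` supported in cell `k′`; a site `x₀` and a radius `ρ₀`.  Then, with
`m₀ = min(μ₀, 1)` and `Γ = L^A e^{(log L/R)ρ₀}`,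
`√(Σ_{q : d_n(q,x₀) ≤ ρ₀}((G′u)(q))²) ≤ e^{−κ(d_n(x₀,t_{k′}) − ρ₀ − 2d)} / √((m₀(Γ n(x₀))⁻²)(m₀S_{l_{k′}}⁻²)) · √(Σ_{cell k′}u²)` —
file 9a's shape, uniformly in the domain. [cite: Balaban1985BackgroundPropagators, Thm 3.1 (3.46) p.398 + (3.86)-(3.88) pp.408-409] [folklore] -/
theorem real_ballNorm_dirInv_le (hμ : 0 < C - 2 * d * cmax ^ 2 * κ ^ 2 - amax * (Real.exp (2 * d * κ) - 1))
    {L : ℕ} (hL : 1 ≤ L) (e : J → ℕ) (hSe : ∀ l, S l = L ^ e l) {R : ℝ} (hR : 0 < R) {A : ℕ}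
    (hadd : ∀ x y : UT N, |(e (lvl (cellOf S hS hdivS lvl zc hcover x)) : ℝ) - e (lvl (cellOf S hS hdivS lvl zc hcover y))| ≤
      A + sdist bsrc btgt (siteScale S hS hdivS lvl zc hcover) x y / R)
    (χ : UT N × Cp → ℝ) (hχ : ∀ p, χ p = 0 ∨ χ p = 1)
    (k' : K) (u : UT N × Cp → ℝ) (hu : ∀ p, cellOf S hS hdivS lvl zc hcover p.1 ≠ k' → u p = 0)
    (x₀ : UT N) (ρ₀ : ℝ) :
    Real.sqrt (∑ q ∈ univ.filter (fun q : UT N × Cp =>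
        sdist bsrc btgt (siteScale S hS hdivS lvl zc hcover) q.1 x₀ ≤ ρ₀),
        (dirInv (levelOp bsrc btgt c Rm (fun l x => ctrU N (S l) (tblk (hS l) (hdivS l) x))
          (fun l x => ω l (ctrU N (S l) (tblk (hS l) (hdivS l) x))) T a) χ) u q ^ 2) ≤
      Real.exp (-(κ * ((sdist bsrc btgt (siteScale S hS hdivS lvl zc hcover) x₀ (ctrU N (S (lvl k')) (zc k')) - ρ₀) - 2 * d))) /
        Real.sqrt ((min (C - 2 * d * cmax ^ 2 * κ ^ 2 - amax * (Real.exp (2 * d * κ) - 1)) 1) *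
            (((L : ℝ) ^ A * Real.exp (Real.log L / R * ρ₀) * (siteScale S hS hdivS lvl zc hcover x₀ : ℝ)) ^ 2)⁻¹ *
          ((min (C - 2 * d * cmax ^ 2 * κ ^ 2 - amax * (Real.exp (2 * d * κ) - 1)) 1) * ((S (lvl k') : ℝ) ^ 2)⁻¹)) *
        Real.sqrt (∑ q ∈ univ.filter (fun q : UT N × Cp => cellOf S hS hdivS lvl zc hcover q.1 = k'), u q ^ 2) := by
  classical
  obtain ⟨i₀⟩ := ‹Nonempty Cp›
  set μ₀ := C - 2 * d * cmax ^ 2 * κ ^ 2 - amax * (Real.exp (2 * d * κ) - 1) with hμ₀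
  set m₀ := min μ₀ 1 with hm₀
  set Aop := levelOp bsrc btgt c Rm (fun l x => ctrU N (S l) (tblk (hS l) (hdivS l) x))
    (fun l x => ω l (ctrU N (S l) (tblk (hS l) (hdivS l) x))) T a with hAop
  set Sw := (mulOp χ * Aop * mulOp χ + mulOp (1 - χ) : Module.End ℝ (UT N × Cp → ℝ)) with hSw
  set n := siteScale S hS hdivS lvl zc hcover with hn
  set tk' : UT N := ctrU N (S (lvl k')) (zc k') with htk'
  set Γ : ℝ := (L : ℝ) ^ A * Real.exp (Real.log L / R * ρ₀) with hΓ
  have hL0 : (0 : ℝ) < L := by exact_mod_cast hL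
  have hΓpos : 0 < Γ := mul_pos (pow_pos hL0 A) (Real.exp_pos _)
  have hm : 0 < m₀ := lt_min hμ zero_lt_one
  have hunit : IsUnit Sw :=
    (decay_dirInv_levelOp S hS hdivS lvl zc hdisj hcover Rm hRm T hT a ha ω hsupp hamax hscale c hc hcoer hκ0 hκ1 hμ χ hχ
      (tk', i₀) (tk', i₀)).1
  have hSpos : ∀ l, (0 : ℝ) < (S l : ℝ) := fun l => by exact_mod_cast hS l
  have hnpos : ∀ x, (0 : ℝ) < (n x : ℝ) := fun x => by exact_mod_cast one_le_siteScale S hS hdivS lvl zc hcover x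
  have hμpos : ∀ p : UT N × Cp, 0 < m₀ * ((n p.1 : ℝ) ^ 2)⁻¹ := fun p =>
    mul_pos hm (inv_pos.mpr (pow_pos (hnpos p.1) 2))
  have hcH : ∀ v : UT N × Cp → ℝ, ∑ p, m₀ * ((n p.1 : ℝ) ^ 2)⁻¹ * v p ^ 2 ≤
      ∑ p, Real.exp (κ * sdist bsrc btgt n p.1 tk') * v p * Sw (fun q => Real.exp (-(κ * sdist bsrc btgt n q.1 tk')) * v q) p :=
    fun v => hc_sandwich S hS hdivS lvl zc hdisj hcover Rm hRm T hT a ha ω hsupp hamax hscale c hc hcoer hκ0 hκ1 χ hχ (tk', i₀) v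
  have hthr := sdist_corner_thresholds S hS hdivS lvl zc hdisj hcover
  have hgr : ∀ x, n x = L ^ (e (lvl (cellOf S hS hdivS lvl zc hcover x))) := fun x => by rw [hn, siteScale, hSe]
  have ht0 : 0 ≤ Real.log L / R := div_nonneg (Real.log_nonneg (by exact_mod_cast hL)) hR.le
  -- the truncated source `χ·u` is still supported in the cell and has a smaller norm
  set uχ : UT N × Cp → ℝ := fun p => χ p * u p with huχ
  have huχsupp : ∀ p, p ∉ univ.filter (fun q : UT N × Cp => cellOf S hS hdivS lvl zc hcover q.1 = k') → uχ p = 0 := by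
    intro p hp
    simp only [huχ, hu p (fun h => hp (mem_filter.mpr ⟨mem_univ _, h⟩)), mul_zero]
  have hχsq : ∀ p, χ p ^ 2 ≤ 1 := fun p => by rcases hχ p with h | h <;> simp [h]
  have hχ0 : ∀ p, 0 ≤ χ p ^ 2 := fun p => sq_nonneg _
  -- file 6 for the sandwich
  have h6 := real_set_norm_inverse_le hunit hμpos hκ0 hcH
    (univ.filter (fun q : UT N × Cp => sdist bsrc btgt n q.1 x₀ ≤ ρ₀))
    (univ.filter (fun q : UT N × Cp => cellOf S hS hdivS lvl zc hcover q.1 = k'))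
    huχsupp (R := sdist bsrc btgt n x₀ tk' - ρ₀) (ω := 2 * d)
    (mul_pos hm (inv_pos.mpr (pow_pos (mul_pos hΓpos (hnpos x₀)) 2)))
    (mul_pos hm (inv_pos.mpr (pow_pos (hSpos (lvl k')) 2)))
    (fun q hq => ?_) (fun q hq => ?_) (fun q hq => ?_) (fun q hq => ?_)
  · -- from the sandwich inverse to `G′`: `(G′u)(q)² = χ(q)²·(Sw⁻¹(χu))(q)² ≤ (Sw⁻¹(χu))(q)²`
    have hpt : ∀ q, dirInv Aop χ u q ^ 2 ≤ (Ring.inverse Sw) uχ q ^ 2 := by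
      intro q
      rw [dirInv_apply_eq, mul_pow]
      calc χ q ^ 2 * (Ring.inverse Sw) uχ q ^ 2 ≤ 1 * (Ring.inverse Sw) uχ q ^ 2 :=
            mul_le_mul_of_nonneg_right (hχsq q) (sq_nonneg _)
        _ = _ := one_mul _
    have hsrc : Real.sqrt (∑ q ∈ univ.filter (fun q : UT N × Cp => cellOf S hS hdivS lvl zc hcover q.1 = k'), uχ q ^ 2) ≤
        Real.sqrt (∑ q ∈ univ.filter (fun q : UT N × Cp => cellOf S hS hdivS lvl zc hcover q.1 = k'), u q ^ 2) := by
      refine Real.sqrt_le_sqrt (Finset.sum_le_sum fun q _ => ?_)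
      simp only [huχ, mul_pow]
      calc χ q ^ 2 * u q ^ 2 ≤ 1 * u q ^ 2 := mul_le_mul_of_nonneg_right (hχsq q) (sq_nonneg _)
        _ = _ := one_mul _
    have hpre : 0 ≤ Real.exp (-(κ * ((sdist bsrc btgt n x₀ tk' - ρ₀) - 2 * d))) /
        Real.sqrt (m₀ * ((Γ * (n x₀ : ℝ)) ^ 2)⁻¹ * (m₀ * ((S (lvl k') : ℝ) ^ 2)⁻¹)) := by positivity
    calc Real.sqrt (∑ q ∈ univ.filter (fun q : UT N × Cp => sdist bsrc btgt n q.1 x₀ ≤ ρ₀), dirInv Aop χ u q ^ 2)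
        ≤ Real.sqrt (∑ q ∈ univ.filter (fun q : UT N × Cp => sdist bsrc btgt n q.1 x₀ ≤ ρ₀), (Ring.inverse Sw) uχ q ^ 2) :=
          Real.sqrt_le_sqrt (Finset.sum_le_sum fun q _ => hpt q)
      _ ≤ Real.exp (-(κ * ((sdist bsrc btgt n x₀ tk' - ρ₀) - 2 * d))) /
            Real.sqrt (m₀ * ((Γ * (n x₀ : ℝ)) ^ 2)⁻¹ * (m₀ * ((S (lvl k') : ℝ) ^ 2)⁻¹)) *
          Real.sqrt (∑ q ∈ univ.filter (fun q : UT N × Cp => cellOf S hS hdivS lvl zc hcover q.1 = k'), uχ q ^ 2) := h6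
      _ ≤ _ := mul_le_mul_of_nonneg_left hsrc hpre
  · -- target floor on the ball
    have hq' : sdist bsrc btgt n q.1 x₀ ≤ ρ₀ := (mem_filter.mp hq).2
    have htri := sdist_triangle_torus n x₀ q.1 tk'
    have hsym : sdist bsrc btgt n x₀ q.1 = sdist bsrc btgt n q.1 x₀ := sdist_comm bsrc btgt n x₀ q.1
    linarith
  · -- source oscillation on cell `k′`
    exact (hthr q.1 k').1 (mem_filter.mp hq).2
  · -- profile floor on the ball: `n(q) ≤ Γ·n(x₀)`
    have hq' : sdist bsrc btgt n q.1 x₀ ≤ ρ₀ := (mem_filter.mp hq).2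
    have hsym : sdist bsrc btgt n x₀ q.1 = sdist bsrc btgt n q.1 x₀ := sdist_comm bsrc btgt n x₀ q.1
    have hsc := scale_le_scale_mul_exp_add bsrc btgt n hL (fun x => e (lvl (cellOf S hS hdivS lvl zc hcover x))) hgr
      (A := A) (hadd x₀ q.1)
    have hle : (n q.1 : ℝ) ≤ Γ * n x₀ := by
      calc (n q.1 : ℝ) ≤ (L : ℝ) ^ A * n x₀ * Real.exp (Real.log L / R * sdist bsrc btgt n x₀ q.1) := hsc
        _ ≤ (L : ℝ) ^ A * n x₀ * Real.exp (Real.log L / R * ρ₀) := by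
            refine mul_le_mul_of_nonneg_left (Real.exp_le_exp.mpr ?_) (by positivity)
            rw [hsym]; exact mul_le_mul_of_nonneg_left hq' ht0
        _ = Γ * n x₀ := by rw [hΓ]; ring
    have hq0 : (0 : ℝ) < n q.1 := hnpos q.1
    refine mul_le_mul_of_nonneg_left ?_ hm.le
    rw [inv_le_inv₀ (pow_pos (mul_pos hΓpos (hnpos x₀)) 2) (pow_pos hq0 2)]
    exact pow_le_pow_left₀ hq0.le hle 2
  · have hpk : cellOf S hS hdivS lvl zc hcover q.1 = k' := (mem_filter.mp hq).2
    have hnq : n q.1 = S (lvl k') := by rw [hn, siteScale, hpk]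
    rw [hnq]

end

end Summit.QuantumFields.BalabanUV.Beta.MultiscaleSupMemberBallDirichlet
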